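import Literature.AlgebraicGeometry.Frobenioids.IrreducibleMorphisms
import Literature.AlgebraicGeometry.Frobenioids.CoAngularPreSteps
import Literature.AlgebraicGeometry.Frobenioids.IrreducibleArithmetic
import Literature.AlgebraicGeometry.Frobenioids.PrimarySteps
import Mathlib.NumberTheory.ArithmeticFunction.Misc
import HarnessLib

/-!
# Frobenioids I, §3: an equivalence between Frobenioids of isotropic type never exchanges steps
# with prime-Frobenius morphisms

Mochizuki, *The geometry of Frobenioids I: the general theory*, Kyushu J. Math. **62** (2008),
Thm. 3.4 (ii)/(iii), kurims pp. 62–66 [cite: MochizukiFrdI2008, Thm. 3.4 (ii) p.62]. The printed proof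
that an equivalence `Ψ : C₁ ⥲ C₂` preserves pre-steps (p. 63) goes through Prop. 1.14 (ii), (iii); the
"⟸" half of Prop. 1.14 (iii) is false as printed (kernel witness: the standard Frobenioid, seat
abc-iut-L1-t11), so that route is not available. This PROOF-ONLY file (seat abc-iut-L1-t13, D-ζ-a,
towards a repaired Thm. 3.4 (ii)) proves the DEGREE half of the matter by a different, elementary
argument using only Def. 1.3 (ii), (iii)(d), Prop. 1.7 (v), Prop. 1.10 (i) and Prop. 1.14 (i):

**Theorem** (`FrdI.not_isPrimeFrobenius_map_of_isStep`). For Frobenioids `C₁`, `C₂` of isotropic type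
(bases only totally epimorphic) and an equivalence `Ψ : C₁ ⥲ C₂`, the image of a step is never a
prime-Frobenius morphism; symmetrically (`FrdI.not_isStep_map_of_isPrimeFrobenius`) the image of a
prime-Frobenius morphism is never a step.

Proof: for a step `s : A → X₁` with (necessarily) irreducible zero divisor `x`, Frobenius conjugation
by morphisms of Frobenius degree `2` (Prop. 1.10 (i)) gives `s ≫ β = α ≫ s̃` with `α`, `β`
prime-Frobenius and `s̃` a pre-step with `Div(s̃) = 2·x`, which splits as `t₁ ≫ t₂` into two steps of
irreducible divisor (Def. 1.3 (iii)(d)); so `m := s ≫ β` has factorisations of lengths `2` and `3` into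
irreducibles. If `Ψ(s)` were prime-Frobenius of degree `p`, the trichotomy of Prop. 1.14 (i) for the
irreducible `g := Ψ(β)` gives: `g` prime-Frobenius ⇒ `Ψ(m)` of Frobenius type with `3 = 2` prime
factors; `g` a step ⇒ `Ψ(m)` a base-isomorphism of prime degree with irreducible divisor, but its
length-`3` factorisation has two steps; `g` an irreducible pull-back ⇒ `Ψ(m)` an isometry whose base is
irreducible yet a composite with two non-invertible factors. Consequently the only way an equivalence
of isotropic Frobenioids could fail to preserve pre-steps is by exchanging irreducible steps with
irreducible pull-back morphisms over FSMI bases (recorded as the open point of the repair); over bases of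
FSM-type (no FSMI-morphisms at all — e.g. connected objects of a Galois category, Rem. 3.1.3) this is
excluded too: `FrdI.isStep_map_of_isOfFSMType`.
No statement of the paper is restated or strengthened.
-/

-- `u.hom` for `u : Aut A`, `(F ⋙ G).obj`, `Ψ.symm.functor = Ψ.inverse`: default transparency.
set_option backward.isDefEq.respectTransparency false

namespace Literature.AlgebraicGeometry.Frobenioids

open CategoryTheory Opposite ArithmeticFunction

universe w v v' u u'

/-! ### Prime-count arithmetic -/

/-- A product of three primes is not a product of two primes (count prime factors). [folklore] -/
private theorem three_primes_ne_two_primes {p₁ p₂ p₃ q₁ q₂ : ℕ} (h₁ : p₁.Prime) (h₂ : p₂.Prime)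
    (h₃ : p₃.Prime) (hq₁ : q₁.Prime) (hq₂ : q₂.Prime) : p₁ * p₂ * p₃ ≠ q₁ * q₂ := by
  intro h
  have := congrArg cardFactors h
  rw [cardFactors_mul (mul_ne_zero h₁.ne_zero h₂.ne_zero) h₃.ne_zero,
    cardFactors_mul h₁.ne_zero h₂.ne_zero, cardFactors_mul hq₁.ne_zero hq₂.ne_zero,
    cardFactors_apply_prime h₁, cardFactors_apply_prime h₂, cardFactors_apply_prime h₃,
    cardFactors_apply_prime hq₁, cardFactors_apply_prime hq₂] at this
  omega

/-- If a prime is written as `a * (b * c)`, two of the three factors are `1`. [folklore] -/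
private theorem two_eq_one_of_prime_eq_mul₃ {p a b c : ℕ} (hp : p.Prime) (h : p = a * (b * c)) :
    (a = 1 ∧ b = 1) ∨ (a = 1 ∧ c = 1) ∨ (b = 1 ∧ c = 1) := by
  rw [h] at hp
  rcases Nat.prime_mul_iff.1 hp with ⟨-, hbc⟩ | ⟨hbc, ha⟩
  · exact Or.inr (Or.inr ⟨Nat.eq_one_of_mul_eq_one_right hbc, Nat.eq_one_of_mul_eq_one_left hbc⟩)
  · rcases Nat.prime_mul_iff.1 hbc with ⟨-, hc⟩ | ⟨-, hb⟩
    · exact Or.inr (Or.inl ⟨ha, hc⟩)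
    · exact Or.inl ⟨ha, hb⟩

namespace FrdI

/-! ### One Frobenioid of isotropic type: local facts -/

section One

variable {D : Type u} [Category.{v} D] {Φ : Dᵒᵖ ⥤ CommMonCat.{w}} {C : Type u'} [Category.{v'} C]
  {F : C ⥤ ElemFrobenioid Φ}

/-- Remark 1.1.1 for a triple composite: `Div(γ₃ ∘ γ₂ ∘ γ₁)` as a product of the three transported
contributions. [cite: MochizukiFrdI2008, Rem. 1.1.1 p.21] -/
theorem div_comp₃ {X Y Z W : C} (γ₁ : X ⟶ Y) (γ₂ : Y ⟶ Z) (γ₃ : Z ⟶ W) :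
    PreFrobenioid.Div F (γ₁ ≫ γ₂ ≫ γ₃) =
      pull Φ (PreFrobenioid.Base F γ₁) (pull Φ (PreFrobenioid.Base F γ₂) (PreFrobenioid.Div F γ₃)) *
        pull Φ (PreFrobenioid.Base F γ₁)
          (PreFrobenioid.Div F γ₂ ^ (PreFrobenioid.degFr F γ₃ : ℕ)) *
        PreFrobenioid.Div F γ₁ ^ ((PreFrobenioid.degFr F γ₂ : ℕ) * (PreFrobenioid.degFr F γ₃ : ℕ)) := by
  rw [PreFrobenioid.div_comp, PreFrobenioid.div_comp, PreFrobenioid.degFr_comp, map_mul, PNat.mul_coe]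

/-- In a Frobenioid of isotropic type an irreducible base-isomorphism is prime-Frobenius or a step
(Prop. 1.14 (i): the pull-back alternative has irreducible, hence non-invertible, base).
[cite: MochizukiFrdI2008, Prop. 1.14 (i) p.41] -/
theorem isPrimeFrobenius_or_isStep_of_isBaseIso (hF : PreFrobenioid.IsFrobenioid F)
    (hiso : ∀ A : C, PreFrobenioid.IsIsotropic F A) {A B : C} {φ : A ⟶ B} (hφ : IsIrreducibleHom φ)
    (hb : PreFrobenioid.IsBaseIso F φ) :
    PreFrobenioid.IsPrimeFrobenius F φ ∨ PreFrobenioid.IsStep F φ := by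
  rcases PreFrobenioid.trichotomy_of_isIrreducibleHom F hF hiso hφ with h | ⟨h, -⟩ | ⟨-, h⟩
  · exact Or.inl h
  · exact Or.inr h
  · exact (h.1 hb).elim

/-- In a Frobenioid of isotropic type an irreducible isometry is prime-Frobenius or a pull-back
morphism with irreducible base (Prop. 1.14 (i): the step alternative is not an isometry).
[cite: MochizukiFrdI2008, Prop. 1.14 (i) p.41] -/
theorem isPrimeFrobenius_or_isPullback_of_isIsometry (hF : PreFrobenioid.IsFrobenioid F)
    (hiso : ∀ A : C, PreFrobenioid.IsIsotropic F A) {A B : C} {φ : A ⟶ B} (hφ : IsIrreducibleHom φ)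
    (hi : PreFrobenioid.IsIsometry F φ) :
    PreFrobenioid.IsPrimeFrobenius F φ ∨
      (PreFrobenioid.IsPullbackMorphism F φ ∧ IsIrreducibleHom (PreFrobenioid.Base F φ)) := by
  rcases PreFrobenioid.trichotomy_of_isIrreducibleHom F hF hiso hφ with h | ⟨h, -⟩ | h
  · exact Or.inl h
  · exact (PreFrobenioid.div_ne_one_of_isStep hiso h hi).elim
  · exact Or.inr h

end One

/-! ### Two Frobenioids of isotropic type and an equivalence -/

section Two

variable {D₁ : Type u} [Category.{v} D₁] {Φ₁ : D₁ᵒᵖ ⥤ CommMonCat.{w}} {C₁ : Type u'}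
  [Category.{v'} C₁] {D₂ : Type u} [Category.{v} D₂] {Φ₂ : D₂ᵒᵖ ⥤ CommMonCat.{w}} {C₂ : Type u'}
  [Category.{v'} C₂] {F₁ : C₁ ⥤ ElemFrobenioid Φ₁} {F₂ : C₂ ⥤ ElemFrobenioid Φ₂}

/-- **An equivalence between Frobenioids of isotropic type never maps a step to a prime-Frobenius
morphism.** [cite: MochizukiFrdI2008, Thm. 3.4 (ii) p.62] -/
theorem not_isPrimeFrobenius_map_of_isStep (hF₁ : PreFrobenioid.IsFrobenioid F₁)
    (hF₂ : PreFrobenioid.IsFrobenioid F₂) (hi₁ : ∀ A : C₁, PreFrobenioid.IsIsotropic F₁ A)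
    (hi₂ : ∀ A : C₂, PreFrobenioid.IsIsotropic F₂ A) (Ψ : C₁ ≌ C₂) {A X₁ : C₁} {s : A ⟶ X₁}
    (hs : PreFrobenioid.IsStep F₁ s) : ¬ PreFrobenioid.IsPrimeFrobenius F₂ (Ψ.functor.map s) := by
  intro hΨs
  have hP₁ := hF₁.isPreFrobenioid
  have hP₂ := hF₂.isPreFrobenioid
  have hD₂ := hP₂.isTotallyEpimorphic_base
  have hSharp₁ : ∀ X : D₁, IsSharp (Φ₁.obj (op X)) := fun X => (hP₁.isDivisorial X).isSharp
  have hSharp₂ : ∀ X : D₂, IsSharp (Φ₂.obj (op X)) := fun X => (hP₂.isDivisorial X).isSharp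
  -- `s` is irreducible with irreducible zero divisor `x`
  have hsirr : IsIrreducibleHom s :=
    (isIrreducibleHom_map_iff Ψ s).1 (hΨs.isIrreducibleHom hF₂ (hi₂ _))
  have hx : IsIrreducibleElt (PreFrobenioid.Div F₁ s) :=
    PreFrobenioid.isIrreducibleElt_div_of_isIrreducibleHom F₁ hF₁ hi₁ hs.1 hsirr
  -- Frobenius conjugation by morphisms of degree `2`
  obtain ⟨A₂, α, hα, hα2⟩ := hF₁.ii_exists A 2
  obtain ⟨Y, β, hβ, hβ2⟩ := hF₁.ii_exists X₁ 2
  have hαβ : PreFrobenioid.degFr F₁ α = PreFrobenioid.degFr F₁ β := hα2.trans hβ2.symm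
  obtain ⟨s', hsq, -⟩ := PreFrobenioid.existsUnique_frobeniusConjugate hF₁ s hα hβ hαβ
  -- hsq : α ≫ s' = s ≫ β
  have hs'p : PreFrobenioid.IsPreStep F₁ s' := hs.1.frobeniusConjugate hF₁ hsq hα hβ hαβ
  haveI : IsIso (PreFrobenioid.Base F₁ α) := hα.2
  have hs'd : PreFrobenioid.Div F₁ s' =
      pull Φ₁ (inv (PreFrobenioid.Base F₁ α)) (PreFrobenioid.Div F₁ s) ^ 2 := by
    have := PreFrobenioid.div_frobeniusConjugate (F := F₁) hsq hα hβ
    rw [hβ2] at this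
    exact this
  have hx₂ : IsIrreducibleElt (pull Φ₁ (inv (PreFrobenioid.Base F₁ α)) (PreFrobenioid.Div F₁ s)) :=
    (isIrreducibleElt_pull_iff Φ₁ _ _).2 hx
  have hαp : PreFrobenioid.IsPrimeFrobenius F₁ α := ⟨hα, by rw [hα2]; exact Nat.prime_two⟩
  have hβp : PreFrobenioid.IsPrimeFrobenius F₁ β := ⟨hβ, by rw [hβ2]; exact Nat.prime_two⟩
  -- split `s' = t₁ ≫ t₂` into two steps with irreducible divisors (Def. 1.3 (iii)(d))
  have hcoa : ∀ {X Y : C₁} (f : X ⟶ Y), PreFrobenioid.IsCoAngular F₁ f := fun f =>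
    PreFrobenioid.isCoAngular_of_isIsotropic_codomains F₁ f fun Z _ => hi₁ Z
  obtain ⟨Z, t₁, ht₁, ht₁d⟩ := hF₁.iii_d_under_surj A₂
    (pull Φ₁ (inv (PreFrobenioid.Base F₁ α)) (PreFrobenioid.Div F₁ s))
  obtain ⟨t₂, ht₂, ht⟩ := hF₁.iii_d_under_full t₁ s' ht₁ ⟨hcoa s', hs'p⟩
    (by rw [ht₁d, hs'd]; exact dvd_pow_self _ two_ne_zero)
  -- ht : t₁ ≫ t₂ = s'
  have ht₂d : pull Φ₁ (PreFrobenioid.Base F₁ t₁) (PreFrobenioid.Div F₁ t₂) =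
      pull Φ₁ (inv (PreFrobenioid.Base F₁ α)) (PreFrobenioid.Div F₁ s) := by
    have e := hs'd
    rw [← ht, PreFrobenioid.div_comp, ht₁d, show PreFrobenioid.degFr F₁ t₂ = 1 from ht₂.2.1,
      PNat.one_coe, pow_one, pow_two] at e
    haveI : IsCancelMul (Φ₁.obj (op (PreFrobenioid.baseObj F₁ A₂))) :=
      isIntegral_iff_isCancelMul.1 (hP₁.isDivisorial _).isPreDivisorial.isIntegral
    exact mul_right_cancel e
  haveI : IsIso (PreFrobenioid.Base F₁ t₁) := ht₁.2.2
  have ht₂x : IsIrreducibleElt (PreFrobenioid.Div F₁ t₂) :=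
    (isIrreducibleElt_pull_iff Φ₁ (PreFrobenioid.Base F₁ t₁) _).1 (by rw [ht₂d]; exact hx₂)
  have ht₁x : IsIrreducibleElt (PreFrobenioid.Div F₁ t₁) := by rw [ht₁d]; exact hx₂
  have ht₁s : PreFrobenioid.IsStep F₁ t₁ :=
    ⟨ht₁.2, fun h => ht₁x.1 (by haveI := h; exact PreFrobenioid.isIsometry_of_isIso F₁ hP₁ t₁)⟩
  have ht₂s : PreFrobenioid.IsStep F₁ t₂ :=
    ⟨ht₂.2, fun h => ht₂x.1 (by haveI := h; exact PreFrobenioid.isIsometry_of_isIso F₁ hP₁ t₂)⟩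
  have ht₁irr : IsIrreducibleHom t₁ := PreFrobenioid.isIrreducibleHom_of_isStep F₁ hP₁ hi₁ ht₁s ht₁x
  have ht₂irr : IsIrreducibleHom t₂ := PreFrobenioid.isIrreducibleHom_of_isStep F₁ hP₁ hi₁ ht₂s ht₂x
  -- the two factorisations of `m := s ≫ β = α ≫ t₁ ≫ t₂`, pushed to `C₂`
  have hm : Ψ.functor.map s ≫ Ψ.functor.map β =
      Ψ.functor.map α ≫ Ψ.functor.map t₁ ≫ Ψ.functor.map t₂ := by
    rw [← Functor.map_comp, ← Functor.map_comp, ← Functor.map_comp, ← hsq, ← ht]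
  have gα : IsIrreducibleHom (Ψ.functor.map α) := (hαp.isIrreducibleHom hF₁ (hi₁ _)).map_equivalence Ψ
  have gt₁ : IsIrreducibleHom (Ψ.functor.map t₁) := ht₁irr.map_equivalence Ψ
  have gt₂ : IsIrreducibleHom (Ψ.functor.map t₂) := ht₂irr.map_equivalence Ψ
  have gβ : IsIrreducibleHom (Ψ.functor.map β) := (hβp.isIrreducibleHom hF₁ (hi₁ _)).map_equivalence Ψ
  -- degrees in `C₂`: linear irreducibles are steps / pull-backs, the rest prime-Frobenius
  -- the Frobenius degree `p` of `Ψ s`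
  set p := (PreFrobenioid.degFr F₂ (Ψ.functor.map s) : ℕ) with hpdef
  have hp : p.Prime := hΨs.2
  have hΨs_iso : PreFrobenioid.IsIsometry F₂ (Ψ.functor.map s) := hΨs.1.1.2
  haveI hΨs_b : IsIso (PreFrobenioid.Base F₂ (Ψ.functor.map s)) := hΨs.1.2
  -- case analysis on `g := Ψ β` (Prop. 1.14 (i))
  rcases PreFrobenioid.trichotomy_of_isIrreducibleHom F₂ hF₂ hi₂ gβ with
      hg | ⟨hgstep, hgx⟩ | ⟨hgpb, hgbase⟩
  · -- (a) `g` prime-Frobenius: `Ψ m` of Frobenius type, `3 = 2` prime factors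
    have hmF : PreFrobenioid.IsFrobeniusType F₂ (Ψ.functor.map α ≫ Ψ.functor.map t₁ ≫ Ψ.functor.map t₂) := by
      rw [← hm]
      exact PreFrobenioid.IsFrobeniusType.comp F₂ hF₂ hΨs.1 hg.1
    obtain ⟨h23, hFα⟩ := PreFrobenioid.isFrobeniusType_factors F₂ hF₂ hmF (hi₂ _)
    obtain ⟨hFt₂, hFt₁⟩ := PreFrobenioid.isFrobeniusType_factors F₂ hF₂ h23 (hi₂ _)
    have pα := (PreFrobenioid.isPrimeFrobenius_iff_isIrreducibleHom hF₂ hFα (hi₂ _)).2 gα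
    have pt₁ := (PreFrobenioid.isPrimeFrobenius_iff_isIrreducibleHom hF₂ hFt₁ (hi₂ _)).2 gt₁
    have pt₂ := (PreFrobenioid.isPrimeFrobenius_iff_isIrreducibleHom hF₂ hFt₂ (hi₂ _)).2 gt₂
    have hd := congrArg (fun φ => (PreFrobenioid.degFr F₂ φ : ℕ)) hm
    simp only [PreFrobenioid.degFr_comp, PNat.mul_coe] at hd
    exact three_primes_ne_two_primes pα.2 pt₁.2 pt₂.2 hp hg.2 (by rw [mul_assoc]; exact hd.symm)
  · -- (b) `g` a step: `Ψ m` a base-isomorphism of degree `p` with irreducible divisor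
    have hmb : PreFrobenioid.IsBaseIso F₂ (Ψ.functor.map α ≫ Ψ.functor.map t₁ ≫ Ψ.functor.map t₂) := by
      rw [← hm]
      exact PreFrobenioid.IsBaseIso.comp F₂ hΨs.1.2 hgstep.1.2
    obtain ⟨hb23, hbα⟩ := PreFrobenioid.isBaseIso_factors F₂ hD₂ hmb
    obtain ⟨hbt₂, hbt₁⟩ := PreFrobenioid.isBaseIso_factors F₂ hD₂ hb23
    -- the divisor of `Ψ m` is irreducible …
    have hmdiv : IsIrreducibleElt (PreFrobenioid.Div F₂ (Ψ.functor.map s ≫ Ψ.functor.map β)) := by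
      rw [PreFrobenioid.div_comp, show PreFrobenioid.Div F₂ (Ψ.functor.map s) = 1 from hΨs_iso, one_pow,
        mul_one]
      exact (isIrreducibleElt_pull_iff Φ₂ _ _).2 hgx
    rw [hm] at hmdiv
    -- … but two of the three factors `Ψ α`, `Ψ t₁`, `Ψ t₂` are steps
    have hP : ∀ {X Y : C₂} {φ : X ⟶ Y}, IsIrreducibleHom φ → PreFrobenioid.IsBaseIso F₂ φ →
        (PreFrobenioid.degFr F₂ φ : ℕ) = 1 → PreFrobenioid.Div F₂ φ ≠ 1 := by
      intro X Y φ hφ hbφ h1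
      rcases isPrimeFrobenius_or_isStep_of_isBaseIso hF₂ hi₂ hφ hbφ with h | h
      · exact ((Nat.Prime.one_lt h.2).ne' h1).elim
      · exact PreFrobenioid.div_ne_one_of_isStep hi₂ h
    have hd := congrArg (fun φ => (PreFrobenioid.degFr F₂ φ : ℕ)) hm
    simp only [PreFrobenioid.degFr_comp, PNat.mul_coe, show (PreFrobenioid.degFr F₂ (Ψ.functor.map β) : ℕ) = 1 by
      rw [show PreFrobenioid.degFr F₂ (Ψ.functor.map β) = 1 from hgstep.1.1, PNat.one_coe], mul_one] at hd
    -- two of the three factors have Frobenius degree `1`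
    have hd' : (p : ℕ) = (PreFrobenioid.degFr F₂ (Ψ.functor.map α) : ℕ) *
        ((PreFrobenioid.degFr F₂ (Ψ.functor.map t₁) : ℕ) * (PreFrobenioid.degFr F₂ (Ψ.functor.map t₂) : ℕ)) := hd
    have htwo := two_eq_one_of_prime_eq_mul₃ hp hd'
    -- the divisor of the triple composite
    have hS := hSharp₂ (PreFrobenioid.baseObj F₂ (Ψ.functor.obj A))
    have hmon := hP₂.isMonoidOn
    rw [div_comp₃] at hmdiv
    refine not_isIrreducibleElt_mul₃ hS ?_ hmdiv
    rcases htwo with ⟨dα, dt₁⟩ | ⟨dα, dt₂⟩ | ⟨dt₁, dt₂⟩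
    · -- `Ψ α`, `Ψ t₁` are steps
      refine Or.inr (Or.inr ⟨?_, ?_⟩)
      · exact pull_ne_one Φ₂ hmon _ (pow_ne_one_of_ne_one (hSharp₂ _) (hP gt₁ hbt₁ dt₁) (PNat.ne_zero _))
      · exact pow_ne_one_of_ne_one hS (hP gα hbα dα) (mul_ne_zero (PNat.ne_zero _) (PNat.ne_zero _))
    · -- `Ψ α`, `Ψ t₂` are steps
      refine Or.inr (Or.inl ⟨?_, ?_⟩)
      · exact pull_ne_one Φ₂ hmon _ (pull_ne_one Φ₂ hmon _ (hP gt₂ hbt₂ dt₂))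
      · exact pow_ne_one_of_ne_one hS (hP gα hbα dα) (mul_ne_zero (PNat.ne_zero _) (PNat.ne_zero _))
    · -- `Ψ t₁`, `Ψ t₂` are steps
      refine Or.inl ⟨?_, ?_⟩
      · exact pull_ne_one Φ₂ hmon _ (pull_ne_one Φ₂ hmon _ (hP gt₂ hbt₂ dt₂))
      · exact pull_ne_one Φ₂ hmon _ (pow_ne_one_of_ne_one (hSharp₂ _) (hP gt₁ hbt₁ dt₁) (PNat.ne_zero _))
  · -- (c) `g` an irreducible pull-back: `Ψ m` an isometry with irreducible base
    have hg' := hF₂.iv_b _ hgpb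
    have hmiso : PreFrobenioid.IsIsometry F₂ (Ψ.functor.map α ≫ Ψ.functor.map t₁ ≫ Ψ.functor.map t₂) := by
      rw [← hm]
      change PreFrobenioid.Div F₂ _ = 1
      rw [PreFrobenioid.div_comp, show PreFrobenioid.Div F₂ (Ψ.functor.map β) = 1 from hg'.1.2, map_one,
        show PreFrobenioid.Div F₂ (Ψ.functor.map s) = 1 from hΨs_iso, one_pow, mul_one]
    obtain ⟨hi23, hiα⟩ := PreFrobenioid.isIsometry_factors F₂ hP₂ hmiso
    obtain ⟨hit₂, hit₁⟩ := PreFrobenioid.isIsometry_factors F₂ hP₂ hi23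
    -- base of `Ψ m` is irreducible
    have hbirr : IsIrreducibleHom (PreFrobenioid.Base F₂ (Ψ.functor.map α) ≫
        PreFrobenioid.Base F₂ (Ψ.functor.map t₁) ≫ PreFrobenioid.Base F₂ (Ψ.functor.map t₂)) := by
      rw [← PreFrobenioid.base_comp, ← PreFrobenioid.base_comp, ← hm, PreFrobenioid.base_comp]
      exact hgbase.of_arrow_iso (asIso (PreFrobenioid.Base F₂ (Ψ.functor.map s))).symm (Iso.refl _) (by simp)
    -- a degree-one irreducible isometry is a pull-back with irreducible (non-invertible) base
    have hQ : ∀ {X Y : C₂} {φ : X ⟶ Y}, IsIrreducibleHom φ → PreFrobenioid.IsIsometry F₂ φ →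
        (PreFrobenioid.degFr F₂ φ : ℕ) = 1 → ¬ IsIso (PreFrobenioid.Base F₂ φ) := by
      intro X Y φ hφ hiφ h1
      rcases isPrimeFrobenius_or_isPullback_of_isIsometry hF₂ hi₂ hφ hiφ with h | h
      · exact ((Nat.Prime.one_lt h.2).ne' h1).elim
      · exact h.2.1
    have hd := congrArg (fun φ => (PreFrobenioid.degFr F₂ φ : ℕ)) hm
    simp only [PreFrobenioid.degFr_comp, PNat.mul_coe, show (PreFrobenioid.degFr F₂ (Ψ.functor.map β) : ℕ) = 1 by
      rw [show PreFrobenioid.degFr F₂ (Ψ.functor.map β) = 1 from hg'.2, PNat.one_coe], mul_one] at hd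
    have hd' : (p : ℕ) = (PreFrobenioid.degFr F₂ (Ψ.functor.map α) : ℕ) *
        ((PreFrobenioid.degFr F₂ (Ψ.functor.map t₁) : ℕ) * (PreFrobenioid.degFr F₂ (Ψ.functor.map t₂) : ℕ)) := hd
    rcases two_eq_one_of_prime_eq_mul₃ hp hd' with
        ⟨dα, dt₁⟩ | ⟨dα, dt₂⟩ | ⟨dt₁, dt₂⟩
    · exact hbirr.not_two_nonIso' hD₂ (hQ gα hiα dα) (hQ gt₁ hit₁ dt₁)
    · exact hbirr.not_two_nonIso'' hD₂ (hQ gα hiα dα) (hQ gt₂ hit₂ dt₂)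
    · exact hbirr.not_two_nonIso hD₂ (hQ gt₁ hit₁ dt₁) (hQ gt₂ hit₂ dt₂)

/-- **An equivalence between Frobenioids of isotropic type never maps a prime-Frobenius morphism to
a step** (the previous statement for `Ψ⁻¹`). [cite: MochizukiFrdI2008, Thm. 3.4 (ii) p.62] -/
theorem not_isStep_map_of_isPrimeFrobenius (hF₁ : PreFrobenioid.IsFrobenioid F₁)
    (hF₂ : PreFrobenioid.IsFrobenioid F₂) (hi₁ : ∀ A : C₁, PreFrobenioid.IsIsotropic F₁ A)
    (hi₂ : ∀ A : C₂, PreFrobenioid.IsIsotropic F₂ A) (Ψ : C₁ ≌ C₂) {A B : C₁} {f : A ⟶ B}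
    (hf : PreFrobenioid.IsPrimeFrobenius F₁ f) : ¬ PreFrobenioid.IsStep F₂ (Ψ.functor.map f) := by
  intro hstep
  have h := not_isPrimeFrobenius_map_of_isStep hF₂ hF₁ hi₂ hi₁ Ψ.symm hstep
  apply h
  -- `Ψ⁻¹ (Ψ f) = η⁻¹ ≫ f ≫ η` is prime-Frobenius
  change PreFrobenioid.IsPrimeFrobenius F₁ (Ψ.inverse.map (Ψ.functor.map f))
  rw [Ψ.inv_fun_map]
  refine ⟨PreFrobenioid.IsFrobeniusType.comp F₁ hF₁
    (PreFrobenioid.isFrobeniusType_of_isIso F₁ hF₁.isPreFrobenioid _)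
    (PreFrobenioid.IsFrobeniusType.comp F₁ hF₁ hf.1
      (PreFrobenioid.isFrobeniusType_of_isIso F₁ hF₁.isPreFrobenioid _)), ?_⟩
  rw [PreFrobenioid.degFr_comp, PreFrobenioid.degFr_comp,
    show PreFrobenioid.degFr F₁ (Ψ.unitInv.app A) = 1 from PreFrobenioid.isLinear_of_isIso F₁ _,
    show PreFrobenioid.degFr F₁ (Ψ.unit.app B) = 1 from PreFrobenioid.isLinear_of_isIso F₁ _,
    one_mul, mul_one]
  exact hf.2

/-- **Corollary (bases of FSM-type, e.g. connected objects of a Galois category, Rem. 3.1.3).** If `D₂`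
is of FSM-type, an equivalence between Frobenioids of isotropic type maps every step with irreducible
zero divisor to a step: by Prop. 1.14 (i) the image is prime-Frobenius (excluded above), a step, or an
irreducible pull-back morphism — but a step is an FSM-morphism (Prop. 1.11 (vii)), FSM-morphisms are
preserved by equivalences, and a pull-back FSM-morphism has FSM base (Prop. 1.11 (vi)), which would be an
FSMI-morphism of `D₂`. [cite: MochizukiFrdI2008, Thm. 3.4 (ii) p.62] -/
theorem isStep_map_of_isOfFSMType (hF₁ : PreFrobenioid.IsFrobenioid F₁)
    (hF₂ : PreFrobenioid.IsFrobenioid F₂) (hi₁ : ∀ A : C₁, PreFrobenioid.IsIsotropic F₁ A)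
    (hi₂ : ∀ A : C₂, PreFrobenioid.IsIsotropic F₂ A) (hD₂ : IsOfFSMType D₂) (Ψ : C₁ ≌ C₂)
    {A X₁ : C₁} {s : A ⟶ X₁} (hs : PreFrobenioid.IsStep F₁ s)
    (hx : IsIrreducibleElt (PreFrobenioid.Div F₁ s)) : PreFrobenioid.IsStep F₂ (Ψ.functor.map s) := by
  have hsirr : IsIrreducibleHom s :=
    PreFrobenioid.isIrreducibleHom_of_isStep F₁ hF₁.isPreFrobenioid hi₁ hs hx
  rcases PreFrobenioid.trichotomy_of_isIrreducibleHom F₂ hF₂ hi₂ (hsirr.map_equivalence Ψ) with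
      h | ⟨h, -⟩ | ⟨hpb, hbase⟩
  · exact (not_isPrimeFrobenius_map_of_isStep hF₁ hF₂ hi₁ hi₂ Ψ hs h).elim
  · exact h
  · have hsFSM : IsFSM s := PreFrobenioid.IsCoAngularPreStep.isFSM hF₁
      ⟨PreFrobenioid.isCoAngular_of_isIsotropic_codomains F₁ s (fun Z _ => hi₁ Z), hs.1⟩
    have hb : IsFSM (PreFrobenioid.Base F₂ (Ψ.functor.map s)) :=
      (PreFrobenioid.isFSM_iff_of_isPullbackMorphism hF₂ hpb).1 (hsFSM.map_equivalence Ψ)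
    exact (hD₂.not_isFSMI _ ⟨hb, hbase⟩).elim

end Two

end FrdI

end Literature.AlgebraicGeometry.Frobenioids
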